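import Mathlib
import Literature.Algebra.Polynomial.FischerInnerProduct
import Summits.NavierStokesRegularity.NavierStokesRegularity.Theorems.ThreadingFluxCentreJetBracketInjective
import HarnessLib

/-!
# Crux `PoloidalLiouville` (stmt-NavierStokesRegularity-1222, wall W1), crux idea «steady-centre-sieve» (ns-idea-15):
# HARMONIC TANGENT RIGIDITY — the algebraic core of L1 `TriaxialToroidalJetRigidity`

Support file (`--supports stmt-NavierStokesRegularity-1222`, helper; cell `ns-wall-extremal`, width hand ns-wall-eng-7 g6,
0 kit).  Pure `MvPolynomial` algebra over `ℝ[X₀, X₁, X₂]`; no analysis.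

Let `q = (q₀, q₁, q₂)` be a polynomial vector field on `ℝ³`, each `qᵢ` homogeneous of degree `k`, which is
* TANGENT to the spheres about the origin: `Σᵢ Xᵢ qᵢ = 0`;
* DIVERGENCE FREE: `Σᵢ ∂ᵢ qᵢ = 0`;
* HARMONIC: `Σⱼ ∂ⱼ∂ⱼ qᵢ = 0` for each `i`;
* and satisfies the LOOP LAW `Σᵢ Xᵢ (Σⱼ aⱼ Xⱼ ∂ⱼ qᵢ − aᵢ qᵢ) = 0` against a diagonal strain `S = diag(a)`.

Elementary identities (Euler's identity for homogeneous polynomials + the derivative of the tangency relation):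
1. `(curl q) × X = (k+1) q` (`cross_curl_zero/one/two`);
2. `curl curl q = ∇ div q − Δ q = 0`, so `κ := curl q` is closed, and by the polynomial Poincaré lemma
   `∇σ = k κ` with `σ := Σⱼ Xⱼ κⱼ` (`pderiv_sigma`); `Δσ = k · div κ = 0`;
3. hence `k(k+1) q = ∇σ × X`: for `k ≥ 1` the field is TOROIDAL, `q = ∇T × X` with `T = σ/(k(k+1))` a HARMONIC
   homogeneous polynomial of degree `k` — the polynomial Mie/toroidal representation, for free in the harmonic case;
4. with `q = ∇T × X` the loop law reads `−2 · W·∇T = 0`, `W = X × SX = eulerTopField a` (`loop_eq_topL`).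
So for pairwise distinct traceless `a` (triaxial strain of a divergence-free field) ns-wall-eng-5's A1 + A2
(`eulerTopFirstIntegrals`, `noHarmonicPolhodeInvariant`) give `T = c₀ + c₁⟪y,Sy⟫`, which has no homogeneous component
of degree `k ∉ {0, 2}`; `k = 0` dies by tangency alone.  MAIN: `harmonicTangentRigidity` — such a `q` with `k ≠ 2`
VANISHES.  (`k = 2` is the genuine exception: `T = ⟪y,Sy⟫`, the polhode family of the card's C1″.)

This is the «first brick» of the kernel proof of the card's lemma L1 (CentreJetSketch l.317): there `q` is the lowest
Taylor term of `curl V` at the centre.  HONEST FRAME: algebra about one crux idea's objects; closes no crux or sketch Prop by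
itself; `PoloidalLiouville` (1222) and NS regularity OPEN.
-/

-- the summit and its single sub-problem share the name (CONVENTIONS §1)
set_option linter.dupNamespace false

noncomputable section

namespace Summit.NavierStokesRegularity.NavierStokesRegularity.Theorems.PoloidalLiouville.CentreJet.HarmonicTangent

open MvPolynomial
open Summit.NavierStokesRegularity.NavierStokesRegularity.Theorems.PoloidalLiouville.CentreJet

/-- Local shorthand-free statement helpers: `∂ᵢ∂ⱼ = ∂ⱼ∂ᵢ` (tree `Literature.Algebra.Polynomial.pderiv_pderiv_comm`). -/
theorem pd_comm (i j : Fin 3) (p : MvPolynomial (Fin 3) ℝ) : pderiv i (pderiv j p) = pderiv j (pderiv i p) :=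
  Literature.Algebra.Polynomial.pderiv_pderiv_comm i j p

variable {k : ℕ} {q : Fin 3 → MvPolynomial (Fin 3) ℝ}

/-! ### 1. Euler + tangency: `(curl q) × X = (k+1) q` -/

/-- Euler's identity for one component, written out on `Fin 3`. -/
theorem euler_three {p : MvPolynomial (Fin 3) ℝ} {n : ℕ} (hp : p.IsHomogeneous n) :
    X 0 * pderiv 0 p + X 1 * pderiv 1 p + X 2 * pderiv 2 p = (n : MvPolynomial (Fin 3) ℝ) * p := by
  have h := hp.sum_X_mul_pderiv
  rw [Fin.sum_univ_three, nsmul_eq_mul] at h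
  exact h

/-- The derivative of the tangency relation `Σ Xₘ qₘ = 0` in direction `i`: `qᵢ + Σₘ Xₘ ∂ᵢ qₘ = 0`. -/
theorem pderiv_tangent (htan : X 0 * q 0 + X 1 * q 1 + X 2 * q 2 = 0) (i : Fin 3) :
    q i + (X 0 * pderiv i (q 0) + X 1 * pderiv i (q 1) + X 2 * pderiv i (q 2)) = 0 := by
  have h := congrArg (pderiv i) htan
  simp only [map_add, Derivation.leibniz, smul_eq_mul, map_zero, pderiv_X] at h
  fin_cases i <;> simp at h ⊢ <;> linear_combination h

/-- `((curl q) × X)₀ = (k+1) q₀`. -/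
theorem cross_curl_zero (hhom : ∀ i, (q i).IsHomogeneous k) (htan : X 0 * q 0 + X 1 * q 1 + X 2 * q 2 = 0) :
    (pderiv 2 (q 0) - pderiv 0 (q 2)) * X 2 - (pderiv 0 (q 1) - pderiv 1 (q 0)) * X 1 =
      ((k : MvPolynomial (Fin 3) ℝ) + 1) * q 0 := by
  have hE := euler_three (hhom 0)
  have hT := pderiv_tangent htan 0
  linear_combination hE - hT

/-- `((curl q) × X)₁ = (k+1) q₁`. -/
theorem cross_curl_one (hhom : ∀ i, (q i).IsHomogeneous k) (htan : X 0 * q 0 + X 1 * q 1 + X 2 * q 2 = 0) :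
    (pderiv 0 (q 1) - pderiv 1 (q 0)) * X 0 - (pderiv 1 (q 2) - pderiv 2 (q 1)) * X 2 =
      ((k : MvPolynomial (Fin 3) ℝ) + 1) * q 1 := by
  have hE := euler_three (hhom 1)
  have hT := pderiv_tangent htan 1
  linear_combination hE - hT

/-- `((curl q) × X)₂ = (k+1) q₂`. -/
theorem cross_curl_two (hhom : ∀ i, (q i).IsHomogeneous k) (htan : X 0 * q 0 + X 1 * q 1 + X 2 * q 2 = 0) :
    (pderiv 1 (q 2) - pderiv 2 (q 1)) * X 1 - (pderiv 2 (q 0) - pderiv 0 (q 2)) * X 0 =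
      ((k : MvPolynomial (Fin 3) ℝ) + 1) * q 2 := by
  have hE := euler_three (hhom 2)
  have hT := pderiv_tangent htan 2
  linear_combination hE - hT

/-! ### 2. Divergence free + harmonic: `curl q` is closed -/

/-- `(curl curl q)₀ = ∂₀ (div q) − Δ q₀`; so it vanishes for divergence-free harmonic `q`. -/
theorem curl_curl_zero (hdiv : pderiv 0 (q 0) + pderiv 1 (q 1) + pderiv 2 (q 2) = 0)
    (hharm : ∀ i, pderiv 0 (pderiv 0 (q i)) + pderiv 1 (pderiv 1 (q i)) + pderiv 2 (pderiv 2 (q i)) = 0) :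
    pderiv 1 (pderiv 0 (q 1) - pderiv 1 (q 0)) = pderiv 2 (pderiv 2 (q 0) - pderiv 0 (q 2)) := by
  have h1 := congrArg (pderiv 0) hdiv
  have h2 := hharm 0
  simp only [map_add, map_zero] at h1
  simp only [map_sub]
  rw [pd_comm 1 0, pd_comm 2 0]
  linear_combination h1 - h2

/-- `(curl curl q)₁ = 0`. -/
theorem curl_curl_one (hdiv : pderiv 0 (q 0) + pderiv 1 (q 1) + pderiv 2 (q 2) = 0)
    (hharm : ∀ i, pderiv 0 (pderiv 0 (q i)) + pderiv 1 (pderiv 1 (q i)) + pderiv 2 (pderiv 2 (q i)) = 0) :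
    pderiv 2 (pderiv 1 (q 2) - pderiv 2 (q 1)) = pderiv 0 (pderiv 0 (q 1) - pderiv 1 (q 0)) := by
  have h1 := congrArg (pderiv 1) hdiv
  have h2 := hharm 1
  simp only [map_add, map_zero] at h1
  simp only [map_sub]
  rw [pd_comm 2 1, pd_comm 0 1]
  linear_combination h1 - h2

/-- `(curl curl q)₂ = 0`. -/
theorem curl_curl_two (hdiv : pderiv 0 (q 0) + pderiv 1 (q 1) + pderiv 2 (q 2) = 0)
    (hharm : ∀ i, pderiv 0 (pderiv 0 (q i)) + pderiv 1 (pderiv 1 (q i)) + pderiv 2 (pderiv 2 (q i)) = 0) :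
    pderiv 0 (pderiv 2 (q 0) - pderiv 0 (q 2)) = pderiv 1 (pderiv 1 (q 2) - pderiv 2 (q 1)) := by
  have h1 := congrArg (pderiv 2) hdiv
  have h2 := hharm 2
  simp only [map_add, map_zero] at h1
  simp only [map_sub]
  rw [pd_comm 0 2, pd_comm 1 2]
  linear_combination h1 - h2

/-- `div curl q = 0` (commuting partial derivatives). -/
theorem div_curl (q : Fin 3 → MvPolynomial (Fin 3) ℝ) :
    pderiv 0 (pderiv 1 (q 2) - pderiv 2 (q 1)) + pderiv 1 (pderiv 2 (q 0) - pderiv 0 (q 2)) +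
      pderiv 2 (pderiv 0 (q 1) - pderiv 1 (q 0)) = 0 := by
  simp only [map_sub]
  rw [pd_comm 0 1, pd_comm 1 2, pd_comm 2 0]
  ring

/-! ### 3. Polynomial Poincaré lemma: `∇(X·κ) = (n+1) κ` for a closed field `κ` homogeneous of degree `n` -/

/-- If `κ` is homogeneous of degree `n` and closed (`∂ᵢκⱼ = ∂ⱼκᵢ`), then `∂ᵢ (Σⱼ Xⱼ κⱼ) = (n+1) κᵢ`. -/
theorem pderiv_sigma {n : ℕ} {κ0 κ1 κ2 : MvPolynomial (Fin 3) ℝ} (hκ0 : κ0.IsHomogeneous n)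
    (hκ1 : κ1.IsHomogeneous n) (hκ2 : κ2.IsHomogeneous n)
    (h01 : pderiv 0 κ1 = pderiv 1 κ0) (h12 : pderiv 1 κ2 = pderiv 2 κ1) (h20 : pderiv 2 κ0 = pderiv 0 κ2)
    (i : Fin 3) :
    pderiv i (X 0 * κ0 + X 1 * κ1 + X 2 * κ2) = ((n : MvPolynomial (Fin 3) ℝ) + 1) * ![κ0, κ1, κ2] i := by
  fin_cases i
  · have hE := euler_three hκ0
    simp only [map_add, Derivation.leibniz, smul_eq_mul, pderiv_X, Fin.zero_eta]
    simp only [Fin.isValue, Pi.single_apply]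
    simp only [Fin.isValue, if_true, one_ne_zero, if_false, Fin.reduceEq, Matrix.cons_val_zero]
    rw [h01, ← h20]
    linear_combination hE
  · have hE := euler_three hκ1
    simp only [map_add, Derivation.leibniz, smul_eq_mul, pderiv_X, Fin.mk_one]
    simp only [Fin.isValue, Pi.single_apply]
    simp only [Fin.isValue, if_true, if_false, Fin.reduceEq, Matrix.cons_val_one, Matrix.cons_val_zero]
    rw [← h01, h12]
    linear_combination hE
  · have hE := euler_three hκ2
    simp only [map_add, Derivation.leibniz, smul_eq_mul, pderiv_X, Fin.reduceFinMk]
    simp only [Fin.isValue, Pi.single_apply]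
    simp only [Fin.isValue, if_true, if_false, Fin.reduceEq, Matrix.cons_val_two, Matrix.tail_cons,
      Matrix.head_cons]
    rw [← h12, h20]
    linear_combination hE

/-! ### 4. The loop law of a toroidal field is the Euler-top derivation of its potential -/

/-- For `q = ∇T × X`: `Σᵢ Xᵢ (Σⱼ aⱼXⱼ∂ⱼqᵢ − aᵢqᵢ) = −2 Σᵢ Wᵢ ∂ᵢT`, `W = eulerTopField a = X × SX`.  (The second
derivatives of `T` drop out by antisymmetry: `X · (v × X) = 0`.) -/
theorem loop_eq_topL (a : Fin 3 → ℝ) (T : MvPolynomial (Fin 3) ℝ) (q : Fin 3 → MvPolynomial (Fin 3) ℝ)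
    (hq0 : q 0 = pderiv 1 T * X 2 - pderiv 2 T * X 1) (hq1 : q 1 = pderiv 2 T * X 0 - pderiv 0 T * X 2)
    (hq2 : q 2 = pderiv 0 T * X 1 - pderiv 1 T * X 0) :
    ∑ i : Fin 3, X i * ((∑ j : Fin 3, C (a j) * X j * pderiv j (q i)) - C (a i) * q i) =
      C (-2) * ∑ i : Fin 3, eulerTopField a i * pderiv i T := by
  simp only [Fin.sum_univ_three, hq0, hq1, hq2, map_sub, Derivation.leibniz, smul_eq_mul, pderiv_X,
    eulerTopField_zero, eulerTopField_one, eulerTopField_two, map_neg, map_ofNat]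
  simp only [Fin.isValue, Pi.single_apply]
  simp only [Fin.isValue, if_true, if_false, Fin.reduceEq, one_ne_zero]
  rw [pd_comm 1 0, pd_comm 2 0, pd_comm 2 1]
  ring

/-! ### 5. The bracket is injective on harmonic forms of every degree `∉ {0, 2}` -/

/-- ns-wall-eng-5's `eq_zero_of_harmonic_eulerTop_integral` for all degrees `n ≠ 0, 2` (the proof is theirs: A1 gives
`T = F(|y|², ⟪y,Sy⟫)`, A2 gives `F = c₀ + c₁ v₁`, and `c₀ + c₁⟪y,Sy⟫` has no component of degree `n`). -/
theorem eq_zero_of_harmonic_eulerTop_integral' (a : Fin 3 → ℝ) (ha : Function.Injective a) (hsum : ∑ i, a i = 0)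
    {n : ℕ} (hn0 : n ≠ 0) (hn2 : n ≠ 2) (T : MvPolynomial (Fin 3) ℝ) (hT : T.IsHomogeneous n)
    (hL : ∑ i : Fin 3, eulerTopField a i * pderiv i T = 0)
    (hΔ : ∑ i : Fin 3, pderiv i (pderiv i T) = 0) : T = 0 := by
  classical
  obtain ⟨F, hF⟩ := eulerTopFirstIntegrals a ha T hL
  have hΔF : ∑ i : Fin 3, pderiv i (pderiv i (aeval ![rhoPoly, strainPoly a] F)) = 0 := by rw [← hF]; exact hΔ
  obtain ⟨c₀, c₁, hc⟩ := noHarmonicPolhodeInvariant a ha hsum F hΔF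
  have hT' : T = C c₀ + C c₁ * strainPoly a := by
    rw [hF, hc]
    simp
  have h0 : homogeneousComponent n (C c₀ : MvPolynomial (Fin 3) ℝ) = 0 := by
    rw [homogeneousComponent_of_mem (isHomogeneous_C (Fin 3) c₀), if_neg (by omega)]
  have h2 : homogeneousComponent n (C c₁ * strainPoly a) = 0 := by
    rw [homogeneousComponent_of_mem ((isHomogeneous_strainPoly a).C_mul c₁), if_neg (by omega)]
  calc T = homogeneousComponent n T := (homogeneousComponent_eq_self hT).symm
    _ = 0 := by rw [hT', map_add, h0, h2, add_zero]

/-! ### Main theorem -/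

/-- **Harmonic tangent rigidity.**  A polynomial vector field `q` on `ℝ³`, homogeneous of degree `k ≠ 2`, tangent to the
spheres about `0`, divergence free, harmonic, and satisfying the loop law against a TRIAXIAL traceless diagonal strain
(`a` injective, `Σ aᵢ = 0`), vanishes. -/
theorem harmonicTangentRigidity (a : Fin 3 → ℝ) (ha : Function.Injective a) (hsum : ∑ i, a i = 0)
    {k : ℕ} (hk : k ≠ 2) (q : Fin 3 → MvPolynomial (Fin 3) ℝ) (hhom : ∀ i, (q i).IsHomogeneous k)
    (htan : ∑ i : Fin 3, X i * q i = 0) (hdiv : ∑ i : Fin 3, pderiv i (q i) = 0)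
    (hharm : ∀ i, ∑ j : Fin 3, pderiv j (pderiv j (q i)) = 0)
    (hloop : ∑ i : Fin 3, X i * ((∑ j : Fin 3, C (a j) * X j * pderiv j (q i)) - C (a i) * q i) = 0) :
    q = 0 := by
  classical
  rw [Fin.sum_univ_three] at htan hdiv
  have hharm' : ∀ i, pderiv 0 (pderiv 0 (q i)) + pderiv 1 (pderiv 1 (q i)) + pderiv 2 (pderiv 2 (q i)) = 0 :=
    fun i => by have := hharm i; rwa [Fin.sum_univ_three] at this
  -- degree `0`: tangency alone
  rcases Nat.eq_zero_or_pos k with rfl | hkpos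
  · funext i
    have hC : ∀ m, q m = C (coeff 0 (q m)) := fun m => by
      rw [← totalDegree_eq_zero_iff_eq_C, totalDegree_zero_iff_isHomogeneous]; exact hhom m
    have h := pderiv_tangent htan i
    rw [hC 0, hC 1, hC 2, pderiv_C, pderiv_C, pderiv_C] at h
    simpa using h
  -- degree `k = n + 1 ≥ 1`
  obtain ⟨n, rfl⟩ : ∃ n, k = n + 1 := ⟨k - 1, by omega⟩
  -- the curl `κ` and its closedness
  set κ0 := pderiv 1 (q 2) - pderiv 2 (q 1) with hκ0
  set κ1 := pderiv 2 (q 0) - pderiv 0 (q 2) with hκ1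
  set κ2 := pderiv 0 (q 1) - pderiv 1 (q 0) with hκ2
  have hpd : ∀ i j, (pderiv j (q i)).IsHomogeneous n := fun i j => by
    simpa using (hhom i).pderiv (i := j)
  have hκ0h : κ0.IsHomogeneous n := (hpd 2 1).sub (hpd 1 2)
  have hκ1h : κ1.IsHomogeneous n := (hpd 0 2).sub (hpd 2 0)
  have hκ2h : κ2.IsHomogeneous n := (hpd 1 0).sub (hpd 0 1)
  have hc0 : pderiv 1 κ2 = pderiv 2 κ1 := curl_curl_zero hdiv hharm'
  have hc1 : pderiv 2 κ0 = pderiv 0 κ2 := curl_curl_one hdiv hharm'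
  have hc2 : pderiv 0 κ1 = pderiv 1 κ0 := curl_curl_two hdiv hharm'
  -- `σ = X·κ`, `∇σ = (n+1) κ`
  set σ := X 0 * κ0 + X 1 * κ1 + X 2 * κ2 with hσ
  have hσd : ∀ i, pderiv i σ = ((n : MvPolynomial (Fin 3) ℝ) + 1) * ![κ0, κ1, κ2] i :=
    fun i => pderiv_sigma hκ0h hκ1h hκ2h hc2 hc0 hc1 i
  -- `(n+1)(n+2) q = ∇σ × X`
  have hx0 : κ1 * X 2 - κ2 * X 1 = ((n : MvPolynomial (Fin 3) ℝ) + 2) * q 0 := by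
    have h := cross_curl_zero hhom htan; push_cast at h; linear_combination h
  have hx1 : κ2 * X 0 - κ0 * X 2 = ((n : MvPolynomial (Fin 3) ℝ) + 2) * q 1 := by
    have h := cross_curl_one hhom htan; push_cast at h; linear_combination h
  have hx2 : κ0 * X 1 - κ1 * X 0 = ((n : MvPolynomial (Fin 3) ℝ) + 2) * q 2 := by
    have h := cross_curl_two hhom htan; push_cast at h; linear_combination h
  -- the potential `T = σ / ((n+1)(n+2))`
  set c : ℝ := (((n : ℝ) + 1) * ((n : ℝ) + 2))⁻¹ with hc
  have hcc : C c * ((n : MvPolynomial (Fin 3) ℝ) + 1) * ((n : MvPolynomial (Fin 3) ℝ) + 2) = 1 := by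
    have h1 : C c * ((n : MvPolynomial (Fin 3) ℝ) + 1) * ((n : MvPolynomial (Fin 3) ℝ) + 2) =
        C (c * (((n : ℝ) + 1) * ((n : ℝ) + 2))) := by
      simp only [map_mul, map_add, map_natCast, map_one, map_ofNat]; ring
    rw [h1, hc, inv_mul_cancel₀ (by positivity), map_one]
  set T := C c * σ with hTdef
  have hTd : ∀ i, pderiv i T = C c * (((n : MvPolynomial (Fin 3) ℝ) + 1) * ![κ0, κ1, κ2] i) := fun i => by
    rw [hTdef, Derivation.leibniz, pderiv_C, smul_zero, add_zero, smul_eq_mul, hσd]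
  have hq0 : q 0 = pderiv 1 T * X 2 - pderiv 2 T * X 1 := by
    rw [hTd, hTd]
    simp only [Matrix.cons_val_one, Matrix.cons_val_zero, Matrix.cons_val_two, Matrix.tail_cons, Matrix.head_cons]
    linear_combination (-(C c * ((n : MvPolynomial (Fin 3) ℝ) + 1))) * hx0 - (q 0) * hcc
  have hq1 : q 1 = pderiv 2 T * X 0 - pderiv 0 T * X 2 := by
    rw [hTd, hTd]
    simp only [Matrix.cons_val_zero, Matrix.cons_val_two, Matrix.tail_cons, Matrix.head_cons]
    linear_combination (-(C c * ((n : MvPolynomial (Fin 3) ℝ) + 1))) * hx1 - (q 1) * hcc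
  have hq2 : q 2 = pderiv 0 T * X 1 - pderiv 1 T * X 0 := by
    rw [hTd, hTd]
    simp only [Matrix.cons_val_zero, Matrix.cons_val_one]
    linear_combination (-(C c * ((n : MvPolynomial (Fin 3) ℝ) + 1))) * hx2 - (q 2) * hcc
  -- `T` is homogeneous of degree `n+1`, harmonic, and a first integral of the Euler top
  have hThom : T.IsHomogeneous (n + 1) := by
    have hX : ∀ (i : Fin 3) (p : MvPolynomial (Fin 3) ℝ), p.IsHomogeneous n →
        ((X i : MvPolynomial (Fin 3) ℝ) * p).IsHomogeneous (n + 1) := fun i p hp => by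
      simpa [add_comm] using (isHomogeneous_X ℝ i).mul hp
    have hσhom : σ.IsHomogeneous (n + 1) := ((hX 0 κ0 hκ0h).add (hX 1 κ1 hκ1h)).add (hX 2 κ2 hκ2h)
    simpa [hTdef] using hσhom.C_mul c
  have hTharm : ∑ i : Fin 3, pderiv i (pderiv i T) = 0 := by
    have hC : C c * ((n : MvPolynomial (Fin 3) ℝ) + 1) = C (c * ((n : ℝ) + 1)) := by
      simp only [map_mul, map_add, map_natCast, map_one]
    have h : ∀ i, pderiv i (pderiv i T) = C (c * ((n : ℝ) + 1)) * pderiv i (![κ0, κ1, κ2] i) := fun i => by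
      rw [hTd i, ← mul_assoc, hC, Derivation.leibniz, pderiv_C, smul_zero, add_zero, smul_eq_mul]
    rw [Fin.sum_univ_three, h, h, h, ← hC]
    simp only [Matrix.cons_val_zero, Matrix.cons_val_one, Matrix.cons_val_two, Matrix.tail_cons, Matrix.head_cons]
    have hdc : pderiv 0 κ0 + pderiv 1 κ1 + pderiv 2 κ2 = 0 := div_curl q
    linear_combination (C c * ((n : MvPolynomial (Fin 3) ℝ) + 1)) * hdc
  have hTL : ∑ i : Fin 3, eulerTopField a i * pderiv i T = 0 := by
    have h := loop_eq_topL a T q hq0 hq1 hq2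
    rw [hloop] at h
    have h2 : C (-2 : ℝ) * ∑ i : Fin 3, eulerTopField a i * pderiv i T = 0 := h.symm
    rcases mul_eq_zero.mp h2 with h3 | h3
    · exact absurd (C_eq_zero.mp h3) (by norm_num)
    · exact h3
  -- A1 + A2: `T = 0`, hence `q = 0`
  have hT0 : T = 0 :=
    eq_zero_of_harmonic_eulerTop_integral' a ha hsum (Nat.succ_ne_zero n) hk T hThom hTL hTharm
  funext i
  fin_cases i
  · simpa [hT0] using hq0
  · simpa [hT0] using hq1
  · simpa [hT0] using hq2

end Summit.NavierStokesRegularity.NavierStokesRegularity.Theorems.PoloidalLiouville.CentreJet.HarmonicTangent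

end
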